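import Summits.SmoothPoincare4.SmoothPoincare4.Theorems.ConvexBisectionAcyclicBisectionExistsPushedPrefixTube
import HarnessLib

/-!
# The pushed prefix sub-handlebody, III: the push of `X₁` into the complement of its attaching
# circles
(file 3/4 of brick (ii-2) "the global pushed embedding `jX₁' : X₁ → M'`" of the sub-goal T3b of
stub `stub_steinRealisation` (NF6), line `modp-braid-orbits` r11, crux
`ConvexBisection.AcyclicBisectionExists`, item stmt-SmoothPoincare4-10508; wave 4, lead c5,
worker Y5)

Let `g : ι → HandleAttachingMap 3 2 X₁` be finitely many attaching maps of 2-handles on a compact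
`X₁` with pairwise disjoint ranges (the lifted suffix maps of V5's compatible split).  In Kosinski's
corner-free model the attached manifold `X = X₁ ∪_g (handles)` contains `X₁ ∖ ⋃ⱼ γⱼ` as an OPEN
DENSE subset (`D₂.jA`), NOT `X₁` itself: to embed `X₁` into `X` (and then into `M'`) one first pushes
`X₁` into `X₁ ∖ ⋃ⱼ γⱼ`.  This file constructs that push `sh : X₁ → X₁` (existentially, with all the
properties the embedding file needs): the identity off the tubes, `g_j ∘ S ∘ g_j⁻¹` on the `j`-th
tube (`S = PushModel.selfPush κ δ`, file 2/4), values off all attaching circles, injective, with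
the fibre description `sh p = g_j y₀ ↔ p = g_j y ∧ y₀ = S y`, and the OPEN "shallow" region
`{p | every tube coordinate of p has ‖y_λ‖² < 1 - 3κ²/4}` on which `sh = id` (its complement is the
compact image of the deep tube ends).

* `index_eq_of_apply_eq`, `apply_mem_coresComplement_iff`, `mem_coresComplement_of_forall_ne`;
* `isCompact_image_tube_ge`, `isOpen_shallow`;
* **`exists_prefixPush`**, `helper_exists_prefixPush` (registered).

Everything here is proved; no named facts, no definitions.

## References
* A. A. Kosinski, *Differential Manifolds* (1993), VI §6–7. [Kosinski1993]
* J. Milnor, *Lectures on the h-cobordism theorem* (1965), §3. [MilnorHCobordism1965]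
-/

noncomputable section

-- the prescribed namespace `Summit.<P>.<Sub>.…` duplicates `SmoothPoincare4` (P = Sub)
set_option linter.dupNamespace false

open scoped Manifold ContDiff Topology

namespace Summit.SmoothPoincare4.SmoothPoincare4.Theorems.AcyclicBisectionExists.ModpBraidOrbits

open Set Function Metric Filter
open Literature.Topology.FourManifolds Literature.Topology.FourManifolds.HandleAttachingMap

section PrefixPush

variable {X₁ : Type*} [TopologicalSpace X₁] [ChartedSpace (EuclideanHalfSpace 4) X₁]
  {ι : Type*} {g : ι → HandleAttachingMap 3 2 X₁} {κ δ : ℝ}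

/-- Points of distinct tubes differ (disjoint ranges). [folklore] -/
theorem index_eq_of_apply_eq (hdisj : Pairwise fun i j => Disjoint (range (g i).toFun) (range (g j).toFun))
    {i j : ι} {y y' : ↥(handleTube 3 2)} (h : (g i).toFun y = (g j).toFun y') : i = j := by
  by_contra hne
  exact Set.disjoint_left.1 (hdisj hne) (mem_range_self y) (h ▸ mem_range_self y')

variable [T2Space X₁] [Finite ι]

/-- **A tube point is off all the attaching circles iff it is off its own**: `g_j y ∉ ⋃ γᵢ` iff
`‖y_λ‖² ≠ 1`. [cite: Kosinski1993, VI §6] -/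
theorem apply_mem_coresComplement_iff (hdisj : Pairwise fun i j => Disjoint (range (g i).toFun) (range (g j).toFun))
    (j : ι) (y : ↥(handleTube 3 2)) :
    (g j).toFun y ∈ coresComplement g ↔ lamSq 2 (y : EuclideanSpace ℝ (Fin 4)) ≠ 1 := by
  rw [mem_coresComplement]
  constructor
  · intro h h1
    exact h j ⟨y, h1, rfl⟩
  · intro h i hi
    obtain ⟨y', hy', he⟩ := (mem_core_iff _).1 hi
    have hij : i = j := index_eq_of_apply_eq hdisj he
    subst hij
    have : y' = y := (g i).injective he
    subst this
    exact h hy'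

/-- A point off all the tubes is off all the attaching circles. [folklore] -/
theorem mem_coresComplement_of_forall_ne {p : X₁} (hp : ∀ (j : ι) (y : ↥(handleTube 3 2)), (g j).toFun y ≠ p) :
    p ∈ coresComplement g := by
  rw [mem_coresComplement]
  rintro i ⟨y, -, he⟩
  exact hp i y he

omit [T2Space X₁] [Finite ι] in
/-- **The image of a deep tube end `{c ≤ ‖y_λ‖²}` (`0 < c`) is compact** (that end is a closed subset
of the closed ball inside `T`). [folklore] -/
theorem isCompact_image_tube_ge (j : ι) {c : ℝ} (hc : 0 < c) :
    IsCompact ((g j).toFun '' {y : ↥(handleTube 3 2) | c ≤ lamSq 2 (y : EuclideanSpace ℝ (Fin 4))}) := by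
  refine IsCompact.image ?_ (g j).continuous
  have hemb : Topology.IsEmbedding fun y : ↥(handleTube 3 2) =>
      ((y : Metric.closedBall (0 : EuclideanSpace ℝ (Fin 4)) 1) : EuclideanSpace ℝ (Fin 4)) :=
    Topology.IsEmbedding.subtypeVal.comp Topology.IsEmbedding.subtypeVal
  rw [hemb.isCompact_iff]
  have heq : (fun y : ↥(handleTube 3 2) => ((y : Metric.closedBall (0 : EuclideanSpace ℝ (Fin 4)) 1) : EuclideanSpace ℝ (Fin 4))) ''
      {y : ↥(handleTube 3 2) | c ≤ lamSq 2 (y : EuclideanSpace ℝ (Fin 4))} =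
      Metric.closedBall (0 : EuclideanSpace ℝ (Fin 4)) 1 ∩ {v | c ≤ lamSq 2 v} := by
    ext v
    constructor
    · rintro ⟨y, hy, rfl⟩
      exact ⟨y.1.2, hy⟩
    · rintro ⟨hv, hcv⟩
      refine ⟨⟨⟨v, hv⟩, ?_⟩, hcv, rfl⟩
      rw [mem_handleTube]
      intro h0
      simp only [mem_setOf_eq] at hcv
      rw [h0] at hcv
      linarith
  rw [heq]
  exact (isCompact_closedBall _ _).inter_right (isClosed_le continuous_const (continuous_lamSq 2))

/-- **The shallow region is open**: the set of points all of whose tube coordinates have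
`‖y_λ‖² < 1 - 3κ²/4` (its complement is the finite union of the compact deep ends). [folklore] -/
theorem isOpen_shallow (hκ : 0 < κ) (hκ2 : κ ≤ 1 / 2) :
    IsOpen {p : X₁ | ∀ (j : ι) (y : ↥(handleTube 3 2)), (g j).toFun y = p →
      lamSq 2 (y : EuclideanSpace ℝ (Fin 4)) < 1 - 3 * κ ^ 2 / 4} := by
  have hc : 0 < 1 - 3 * κ ^ 2 / 4 := by nlinarith
  have hcl : IsClosed (⋃ j : ι, (g j).toFun '' {y : ↥(handleTube 3 2) | 1 - 3 * κ ^ 2 / 4 ≤ lamSq 2 (y : EuclideanSpace ℝ (Fin 4))}) :=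
    isClosed_iUnion_of_finite fun j => (isCompact_image_tube_ge j hc).isClosed
  convert hcl.isOpen_compl using 1
  ext p
  simp only [mem_setOf_eq, mem_compl_iff, mem_iUnion, mem_image, not_exists, not_and]
  constructor
  · intro h j y hy he
    exact absurd (h j y he) (not_lt.2 hy)
  · intro h j y he
    exact not_le.1 fun hy => h j y hy he

open PushModel in
open Classical in
/-- **THE PUSH OF `X₁` INTO THE COMPLEMENT OF ITS ATTACHING CIRCLES.**  For finitely many attaching
maps `g_j : T → X₁` with disjoint ranges and `0 < κ ≤ 1/2`, `0 < δ ≤ 1/2` there is `sh : X₁ → X₁`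
with: `sh = id` off the tubes; `sh (g_j y) = g_j (S y)` (`S = selfPush κ δ`); values off all the
circles `γⱼ`; injective; fibres `sh p = g_j y₀ ⇒ p = g_j y`, `y₀ = S y`; and `sh = id` at every
point all of whose tube coordinates have `‖y_λ‖² ≤ 1 - 3κ²/4`. [cite: MilnorHCobordism1965, §3] -/
theorem exists_prefixPush (hκ : 0 < κ) (hκ2 : κ ≤ 1 / 2) (hδ : 0 < δ) (hδ2 : δ ≤ 1 / 2)
    (hdisj : Pairwise fun i j => Disjoint (range (g i).toFun) (range (g j).toFun)) :
    ∃ sh : X₁ → X₁,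
      (∀ p : X₁, (∀ (j : ι) (y : ↥(handleTube 3 2)), (g j).toFun y ≠ p) → sh p = p) ∧
      (∀ (j : ι) (y y' : ↥(handleTube 3 2)),
        (y' : EuclideanSpace ℝ (Fin 4)) = selfPush κ δ (y : EuclideanSpace ℝ (Fin 4)) →
          sh ((g j).toFun y) = (g j).toFun y') ∧
      (∀ p : X₁, sh p ∈ coresComplement g) ∧
      Injective sh ∧
      (∀ (p : X₁) (j : ι) (y₀ : ↥(handleTube 3 2)), sh p = (g j).toFun y₀ →
        ∃ y : ↥(handleTube 3 2), p = (g j).toFun y ∧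
          (y₀ : EuclideanSpace ℝ (Fin 4)) = selfPush κ δ (y : EuclideanSpace ℝ (Fin 4))) ∧
      (∀ p : X₁, (∀ (j : ι) (y : ↥(handleTube 3 2)), (g j).toFun y = p →
        lamSq 2 (y : EuclideanSpace ℝ (Fin 4)) ≤ 1 - 3 * κ ^ 2 / 4) → sh p = p) := by
  -- the pushed tube point
  have hT : ∀ y : ↥(handleTube 3 2), ‖(y : EuclideanSpace ℝ (Fin 4))‖ ≤ 1 ∧ lamPart (y : EuclideanSpace ℝ (Fin 4)) ≠ 0 :=
    fun y => ⟨mem_closedBall_zero_iff.1 y.1.2,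
      sOf_pos_iff.1 (by rw [sOf_eq_lamSq]; exact lt_of_le_of_ne (lamSq_nonneg 2 _) (Ne.symm y.2))⟩
  have hS : ∀ y : ↥(handleTube 3 2),
      selfPush κ δ (y : EuclideanSpace ℝ (Fin 4)) ∈ Metric.closedBall (0 : EuclideanSpace ℝ (Fin 4)) 1 ∧
        lamSq 2 (selfPush κ δ (y : EuclideanSpace ℝ (Fin 4))) ≠ 0 ∧
        lamSq 2 (selfPush κ δ (y : EuclideanSpace ℝ (Fin 4))) ≠ 1 := by
    intro y
    obtain ⟨h1, h2, h3⟩ := selfPush_mem_tube hκ hκ2 hδ hδ2 (hT y).1 (hT y).2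
    rw [sOf_eq_lamSq] at h2 h3
    exact ⟨mem_closedBall_zero_iff.2 h1, h2.ne', h3.ne⟩
  let Sb : ↥(handleTube 3 2) → ↥(handleTube 3 2) := fun y =>
    ⟨⟨selfPush κ δ (y : EuclideanSpace ℝ (Fin 4)), (hS y).1⟩, by rw [mem_handleTube]; exact (hS y).2.1⟩
  have hSb : ∀ y, ((Sb y : ↥(handleTube 3 2)) : EuclideanSpace ℝ (Fin 4)) = selfPush κ δ (y : EuclideanSpace ℝ (Fin 4)) :=
    fun y => rfl
  have hSb_inj : Injective Sb := fun y₁ y₂ h =>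
    Subtype.ext (Subtype.ext (selfPush_injOn_tube hκ hκ2 hδ (hT y₁) (hT y₂) (congrArg (fun z : ↥(handleTube 3 2) => (z : EuclideanSpace ℝ (Fin 4))) h)))
  -- the push
  let sh : X₁ → X₁ := fun p =>
    if h : ∃ (j : ι) (y : ↥(handleTube 3 2)), (g j).toFun y = p then (g h.choose).toFun (Sb h.choose_spec.choose) else p
  -- the tube formula
  have key : ∀ (j : ι) (y : ↥(handleTube 3 2)), sh ((g j).toFun y) = (g j).toFun (Sb y) := by
    intro j y
    have h : ∃ (j' : ι) (y' : ↥(handleTube 3 2)), (g j').toFun y' = (g j).toFun y := ⟨j, y, rfl⟩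
    have gen : ∀ (j' : ι) (y' : ↥(handleTube 3 2)), (g j').toFun y' = (g j).toFun y →
        (g j').toFun (Sb y') = (g j).toFun (Sb y) := by
      intro j' y' he
      have hjj : j' = j := index_eq_of_apply_eq hdisj he
      subst hjj
      have : y' = y := (g j').injective he
      subst this
      rfl
    show (if h : ∃ (j' : ι) (y' : ↥(handleTube 3 2)), (g j').toFun y' = (g j).toFun y then
      (g h.choose).toFun (Sb h.choose_spec.choose) else (g j).toFun y) = _
    rw [dif_pos h]
    exact gen _ _ h.choose_spec.choose_spec
  have hoff : ∀ p : X₁, (∀ (j : ι) (y : ↥(handleTube 3 2)), (g j).toFun y ≠ p) → sh p = p := by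
    intro p hp
    show (if h : ∃ (j' : ι) (y' : ↥(handleTube 3 2)), (g j').toFun y' = p then
      (g h.choose).toFun (Sb h.choose_spec.choose) else p) = p
    rw [dif_neg]
    rintro ⟨j, y, he⟩
    exact hp j y he
  -- fibres
  have hfib : ∀ (p : X₁) (j : ι) (y₀ : ↥(handleTube 3 2)), sh p = (g j).toFun y₀ →
      ∃ y : ↥(handleTube 3 2), p = (g j).toFun y ∧ Sb y = y₀ := by
    intro p j y₀ he
    by_cases h : ∃ (i : ι) (y : ↥(handleTube 3 2)), (g i).toFun y = p
    · obtain ⟨i, y, rfl⟩ := h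
      rw [key] at he
      have hij : i = j := index_eq_of_apply_eq hdisj he
      subst hij
      exact ⟨y, rfl, (g i).injective he⟩
    · push Not at h
      rw [hoff p h] at he
      exact absurd he.symm (h j y₀)
  refine ⟨sh, hoff, fun j y y' hy' => ?_, fun p => ?_, fun p q hpq => ?_, fun p j y₀ he => ?_, fun p hp => ?_⟩
  · -- tube formula with a prescribed pushed point
    rw [key]
    congr 1
    exact (Subtype.ext (Subtype.ext hy'.symm) : Sb y = y').symm ▸ rfl
  · -- values off the circles
    by_cases h : ∃ (j : ι) (y : ↥(handleTube 3 2)), (g j).toFun y = p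
    · obtain ⟨j, y, rfl⟩ := h
      rw [key, apply_mem_coresComplement_iff hdisj]
      exact (hS y).2.2
    · push Not at h
      rw [hoff p h]
      exact mem_coresComplement_of_forall_ne h
  · -- injectivity
    by_cases hp : ∃ (j : ι) (y : ↥(handleTube 3 2)), (g j).toFun y = p
    · obtain ⟨j, y, rfl⟩ := hp
      rw [key] at hpq
      obtain ⟨y', rfl, hy'⟩ := hfib q j (Sb y) hpq.symm
      rw [hSb_inj hy']
    · push Not at hp
      rw [hoff p hp] at hpq
      by_cases hq : ∃ (j : ι) (y : ↥(handleTube 3 2)), (g j).toFun y = q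
      · obtain ⟨j, y, rfl⟩ := hq
        rw [key] at hpq
        exact absurd hpq (hp j _).symm
      · push Not at hq
        rw [hoff q hq] at hpq
        exact hpq
  · -- fibres, vector form
    obtain ⟨y, rfl, hy⟩ := hfib p j y₀ he
    exact ⟨y, rfl, by rw [← hy]⟩
  · -- the shallow region
    by_cases h : ∃ (j : ι) (y : ↥(handleTube 3 2)), (g j).toFun y = p
    · obtain ⟨j, y, rfl⟩ := h
      rw [key]
      congr 1
      apply Subtype.ext; apply Subtype.ext
      show selfPush κ δ (y : EuclideanSpace ℝ (Fin 4)) = y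
      have h0 : 0 < sOf (y : EuclideanSpace ℝ (Fin 4)) := sOf_pos_iff.2 (hT y).2
      exact selfPush_of_le hκ hκ2 hδ h0 (by rw [sOf_eq_lamSq]; exact hp j y rfl)
    · push Not at h
      exact hoff p h

end PrefixPush

/-- **Registered helper `helper_exists_prefixPush` (file 3/4 of brick (ii-2) of T3b, sub-goal of
NF6 `stub_steinRealisation`, wave 4, lead c5): the push of `X₁` into the complement of its
attaching circles, with its defining formulas, injectivity, fibres and identity region.**
[cite: MilnorHCobordism1965, §3] -/
theorem helper_exists_prefixPush : ∀ {X₁ : Type*} [TopologicalSpace X₁] [ChartedSpace (EuclideanHalfSpace 4) X₁] {ι : Type*} {g : ι → Literature.Topology.FourManifolds.HandleAttachingMap 3 2 X₁} {κ δ : ℝ} [T2Space X₁] [Finite ι], 0 < κ → κ ≤ 1 / 2 → 0 < δ → δ ≤ 1 / 2 → (Pairwise fun i j => Disjoint (Set.range (g i).toFun) (Set.range (g j).toFun)) → ∃ sh : X₁ → X₁, (∀ p : X₁, (∀ (j : ι) (y : ↥(Literature.Topology.FourManifolds.handleTube 3 2)), (g j).toFun y ≠ p) → sh p = p) ∧ (∀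 (j : ι) (y y' : ↥(Literature.Topology.FourManifolds.handleTube 3 2)), (y' : EuclideanSpace ℝ (Fin 4)) = Summit.SmoothPoincare4.SmoothPoincare4.Theorems.AcyclicBisectionExists.ModpBraidOrbits.PushModel.selfPush κ δ (y : EuclideanSpace ℝ (Fin 4)) → sh ((g j).toFun y) = (g j).toFun y') ∧ (∀ p : X₁, sh p ∈ Literature.Topology.FourManifolds.HandleAttachingMap.coresComplement g) ∧ Function.Injective sh ∧ (∀ (p : X₁) (j : ι) (y₀ : ↥(Literature.Topology.FourManifolds.handleTube 3 2)), sh p = (g j).toFun y₀ → ∃ y : ↥(Literature.Topology.FourManifolds.handleTube 3 2), p = (g j).toFun y ∧ (y₀ : EuclideanSpace ℝ (Fin 4)) = Summit.SmoothPoincare4.SmoothPoincare4.Theorems.AcyclicBisectionExists.ModpBraidOrbits.PushModel.selfPush κ δ (y : EuclideanSpace ℝ (Fin 4))) ∧ (∀ p : X₁, (∀ (j : ι) (y : ↥(Literature.Topology.FourManifolds.handleTube 3 2)), (g j).toFun y = p → Literature.Topology.FourManifolds.lamSq 2 (y : EuclideanSpace ℝ (Fin 4)) ≤ 1 - 3 *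 κ ^ 2 / 4) → sh p = p) := by
  intro X₁ _ _ ι g κ δ _ _ hκ hκ2 hδ hδ2 hdisj
  exact exists_prefixPush hκ hκ2 hδ hδ2 hdisj

end Summit.SmoothPoincare4.SmoothPoincare4.Theorems.AcyclicBisectionExists.ModpBraidOrbits

end
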